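import Mathlib
import Summits.ResolutionOfSingularities.ResolutionOfSingularities.Theorems.RadicialJungCleanModelsCentreBlowupChartTwo
import Summits.ResolutionOfSingularities.ResolutionOfSingularities.Theorems.RadicialJungCleanModelsCleanRegTransport
import Literature.AlgebraicGeometry.Resolution.BlowupStalkCharts
import Literature.AlgebraicGeometry.Resolution.RegularSystemOfParameters
import Literature.AlgebraicGeometry.Motives.CartierDivisor
import HarnessLib

/-!
# Route `RadicialJung`, crux `CleanModels` (stmt-ResolutionOfSingularities-15917), line `Sketch` rev 18, stub 4e
# `stub_cleanPrincipalization3`: CLEANNESS SURVIVES THE BLOWING UP OF A CLEAN-PERMISSIBLE REGULAR CENTRE (scheme level)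

Lens-5 g6 STUBPLAN §7 (L7a) / lead memo `Cruxes/CleanModels/Lines/Sketch-memo-open-stubs.md` §1 (i), dimension-free; the curve
analogue of the landed 4d `stub_cleanPointBlowup` (✓ p671162), which it contains as the case «centre = the closed point».  For an
integral scheme `S` with function field of characteristic `p`, an ideal sheaf `J` on `S` and `G ∈ K(S)`, say that the `K^p`-line of
`G` is **clean-permissible at `s` for `J`** if `𝒪_{S,s}` is regular with a regular system of parameters `(c, w)` such that
`J_s = (c)` (near `s`, `V(J)` is a regular centre through `s`) and some non-trivial representative `Σ c_j^p G^j` of the line is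
`u · ∏ c_k^{a_k} · ∏ w_m^{b_m}` with `u` a unit and SOME exponent prime to `p` (loose clean form (1) in coordinates ADAPTED TO THE
CENTRE; form (3) is its exponent-one case after the shift `G ↦ G - c^p`), or a unit `u` with `ū ∉ κ(s)^p` (form (2)).  The
predicate is spelled out inline (no new definition).  PROVED:

* `cleanRegAt_of_isBlowup_of_cleanPermissible` — if the line is clean-permissible at `s` for `J` and `τ : S' → S` is a blowing up
  along `J` (`IsBlowup`), the line of `τ^♯ G` is clean-regular (`CleanRegAt`) at every `s' ∈ S'` over `s`
  (`IsBlowup.exists_reesChart_stalk` + the local-algebra theorem `cleanRegAt_of_centreBlowupCharts`);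
* `cleanRegAt_of_isBlowup_of_not_mem_support` — off `V(J)` a blowing up is a local isomorphism, so clean-regularity is transported
  (`IsBlowup.isIso_compl`, `CleanRegAt.functionFieldMap_of_isIso_stalkMap`);
* `cleanPermissible_of_cleanRegAt` — where `J_s = 𝔪_s` (the centre is the closed point `s`, or `s` is a generic point of the
  centre) clean-regularity already IS clean-permissibility (every regular system of parameters is adapted; form (3) is shifted to
  form (1) with `m = 1` by `stub_extendParameter` + `exists_rep_twist`);
* `cleanRegAt_of_isBlowup_step` — **THE STEP**: if the line of `G` is clean-regular at every point of `S` and clean-permissible for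
  `J` at every point of `V(J)`, then after ANY blowing up `τ : S' → S` along `J` the line of `τ^♯ G` is clean-regular at EVERY point
  of `S'`.  With `IsRegularCentreBlowupSeq.cons` this is the induction step reducing 4e to the existence of a Cossart–Piltant
  principalization of `J` all of whose centres are clean-permissible when blown up (lens-5 L7b + L7c, the research residue).

Honest framing: OURS; nothing here proves resolution in characteristic `p` or any case of `CleanModels`.
-/

noncomputable section

set_option linter.dupNamespace false -- mandated namespace of this single-conjunct summit

open IsLocalRing CategoryTheory AlgebraicGeometry TopologicalSpace
open Literature.AlgebraicGeometry.Resolution Literature.AlgebraicGeometry.Motives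

namespace Summit.ResolutionOfSingularities.ResolutionOfSingularities.Theorems.RadicialJung.CleanModels

universe u

/-! ## Clean-permissibility where the centre ideal is the maximal ideal -/

/-- **Where `I = 𝔪`, clean-regular is clean-permissible.**  If the line of `G` is clean-regular at the local ring `R` (read in `F`
by an injective `f`), then it is clean-permissible at `R` for the maximal ideal: form (1) `u ∏_{i<m} t_i^{a_i}` in a regular system of
parameters `t` is a monomial in `(c, w) = (t, ∅)` with the exponent `a_0` prime to `p`; form (2) is kept (any regular system of
parameters); form (3) `s`, `s - c^p ∈ 𝔪 ∖ 𝔪²`, becomes the coordinate `t_0 = s - c^p` of a regular system of parameters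
(`stub_extendParameter`) for the shifted representative (`exists_rep_twist`). [folklore] -/
theorem cleanPermissible_of_cleanRegAt {R F : Type u} [CommRing R] [Field F] (p : ℕ) [hp : Fact p.Prime]
    [CharP F p] (f : R →+* F) {G : F} (h : CleanRegAt p f G) :
    ∃ (_ : IsRegularLocalRing R) (n l : ℕ) (c : Fin n → R) (w : Fin l → R),
      Ideal.span (Set.range (Fin.append c w)) = maximalIdeal R ∧ ringKrullDim R = ((n + l : ℕ) : WithBot ℕ∞) ∧
      Ideal.span (Set.range c) = maximalIdeal R ∧
      ∃ (cc : Fin p → F), (∃ j : Fin p, (j : ℕ) ≠ 0 ∧ cc j ≠ 0) ∧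
        ((∃ (a : Fin n → ℕ) (b : Fin l → ℕ) (u : R), IsUnit u ∧ ((∃ k, ¬ p ∣ a k) ∨ (∃ m, ¬ p ∣ b m)) ∧
            (∑ j : Fin p, cc j ^ p * G ^ (j : ℕ)) = f (u * (∏ k, c k ^ a k) * ∏ m, w m ^ b m)) ∨
          (∃ u : R, IsUnit u ∧ (∑ j : Fin p, cc j ^ p * G ^ (j : ℕ)) = f u ∧
            ∀ c' : R, u - c' ^ p ∉ maximalIdeal R)) := by
  classical
  obtain ⟨hreg, cc, hcc, hform⟩ := h
  -- appending the empty family does not change the span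
  have happ : ∀ {d : ℕ} (t : Fin d → R), Ideal.span (Set.range (Fin.append t Fin.elim0)) = Ideal.span (Set.range t) := by
    intro d t
    rw [Fin.append_elim0]
    have hsurj : Function.Surjective (Fin.cast (Nat.add_zero d)) := fun i =>
      ⟨Fin.cast (Nat.add_zero d).symm i, Fin.ext rfl⟩
    rw [hsurj.range_comp]
  rcases hform with ⟨d, m, hmd, t, a, u, hu, hspan, hdim, hm, ha, hX⟩ | ⟨u, hu, hX, hup⟩ | ⟨s, c₁, hX, h1, h2⟩
  · -- form (1): exponents `a` on the first `m` coordinates, `0` on the others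
    let emb : Fin m ↪ Fin d := ⟨Fin.castLE hmd, Fin.castLE_injective hmd⟩
    let a' : Fin d → ℕ := fun k => if hk : ∃ i : Fin m, Fin.castLE hmd i = k then a hk.choose else 0
    have ha'emb : ∀ i : Fin m, a' (Fin.castLE hmd i) = a i := by
      intro i
      have hk : ∃ i' : Fin m, Fin.castLE hmd i' = Fin.castLE hmd i := ⟨i, rfl⟩
      simp only [a', hk, dif_pos]
      congr 1
      exact Fin.castLE_injective hmd hk.choose_spec
    have hprod : ∏ k, t k ^ a' k = ∏ i : Fin m, t (Fin.castLE hmd i) ^ a i := by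
      have h1 : ∏ i : Fin m, t (Fin.castLE hmd i) ^ a i = ∏ k ∈ Finset.univ.map emb, t k ^ a' k := by
        rw [Finset.prod_map]
        exact Finset.prod_congr rfl fun i _ => by rw [show emb i = Fin.castLE hmd i from rfl, ha'emb]
      rw [h1]
      symm
      refine Finset.prod_subset (Finset.subset_univ _) fun k _ hk => ?_
      have hk' : ¬ ∃ i : Fin m, Fin.castLE hmd i = k := by
        rintro ⟨i, rfl⟩
        exact hk (Finset.mem_map.mpr ⟨i, Finset.mem_univ _, rfl⟩)
      simp only [a', hk', dif_neg, not_false_eq_true, pow_zero]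
    refine ⟨hreg, d, 0, t, Fin.elim0, (happ t).trans hspan, by simpa using hdim, hspan, cc, hcc, Or.inl ⟨a', Fin.elim0, u, hu,
      Or.inl ⟨Fin.castLE hmd ⟨0, hm⟩, by rw [ha'emb]; exact ha _⟩, ?_⟩⟩
    rw [hX, hprod]
    simp
  · -- form (2): any regular system of parameters
    obtain ⟨t, ht⟩ := exists_regularSystemOfParameters (R := R)
    refine ⟨hreg, _, 0, t, Fin.elim0, (happ t).trans ht, ?_, ht, cc, hcc, Or.inr ⟨u, hu, hX, hup⟩⟩
    rw [Nat.add_zero, ← IsRegularLocalRing.spanFinrank_maximalIdeal (R := R)]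
  · -- form (3): shift the representative by `f(c₁)^p` and use the regular parameter `s - c₁^p` as a coordinate
    obtain ⟨d, hd0, t, hspan, hdim, ht0⟩ := stub_extendParameter (s - c₁ ^ p) h1 h2
    obtain ⟨cc', hcc', hsum⟩ := exists_rep_twist p G cc hcc 1 (f c₁) one_ne_zero
    let a' : Fin d → ℕ := fun k => if k = ⟨0, hd0⟩ then 1 else 0
    have hprod : ∏ k, t k ^ a' k = t ⟨0, hd0⟩ := by
      rw [Finset.prod_eq_single ⟨0, hd0⟩ (fun k _ hk => by simp [a', hk]) (fun h => absurd (Finset.mem_univ _) h)]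
      simp [a']
    refine ⟨hreg, d, 0, t, Fin.elim0, (happ t).trans hspan, by simpa using hdim, hspan, cc', hcc', Or.inl ⟨a', Fin.elim0, 1,
      isUnit_one, Or.inl ⟨⟨0, hd0⟩, by simp [a', hp.out.ne_one]⟩, ?_⟩⟩
    rw [hsum, one_pow, one_mul, hX, ← map_pow, ← map_sub, hprod, ht0]
    simp

/-! ## Over the centre: clean-permissible points -/

/-- **CLEANNESS SURVIVES THE BLOWING UP OF A CLEAN-PERMISSIBLE REGULAR CENTRE, over the centre** (dimension-free; Piltant 2013
Axiom 2 (ii) / Axiom 4 for `P_clean` at the points of a permissible centre; lens-5 L7a).  If the `K^p`-line of `G` is clean-permissible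
at `s` for the ideal sheaf `J` (module docstring), then for every blowing up `τ : S' → S` along `J` and every `s' ∈ S'` over `s`, the
line of `τ^♯ G` is clean-regular at `s'`. [cite: Piltant2013, §2 Axiom 2 (ii)] -/
theorem cleanRegAt_of_isBlowup_of_cleanPermissible (p : ℕ) (hp : p.Prime) {S : Scheme.{0}} [IsIntegral S]
    (hchar : CharP S.functionField p) (G : S.functionField) (J : S.IdealSheafData) (s : S)
    (hperm : ∃ (_ : IsRegularLocalRing (S.presheaf.stalk s)) (n l : ℕ) (c : Fin n → S.presheaf.stalk s)
        (w : Fin l → S.presheaf.stalk s),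
      Ideal.span (Set.range (Fin.append c w)) = maximalIdeal (S.presheaf.stalk s) ∧
      ringKrullDim (S.presheaf.stalk s) = ((n + l : ℕ) : WithBot ℕ∞) ∧
      Ideal.span (Set.range c) = stalkIdeal J s ∧
      ∃ (cc : Fin p → S.functionField), (∃ j : Fin p, (j : ℕ) ≠ 0 ∧ cc j ≠ 0) ∧
        ((∃ (a : Fin n → ℕ) (b : Fin l → ℕ) (u : S.presheaf.stalk s), IsUnit u ∧
            ((∃ k, ¬ p ∣ a k) ∨ (∃ m, ¬ p ∣ b m)) ∧
            (∑ j : Fin p, cc j ^ p * G ^ (j : ℕ)) =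
              algebraMap (S.presheaf.stalk s) S.functionField (u * (∏ k, c k ^ a k) * ∏ m, w m ^ b m)) ∨
          (∃ u : S.presheaf.stalk s, IsUnit u ∧
            (∑ j : Fin p, cc j ^ p * G ^ (j : ℕ)) = algebraMap (S.presheaf.stalk s) S.functionField u ∧
            ∀ c' : S.presheaf.stalk s, u - c' ^ p ∉ maximalIdeal (S.presheaf.stalk s))))
    {S' : Scheme.{0}} (τ : S' ⟶ S) [IsIntegral S'] [IsDominant τ] (hτ : IsBlowup τ J) (s' : S') (hs' : τ s' = s) :
    CleanRegAt p (algebraMap (S'.presheaf.stalk s') S'.functionField) (RatFn.functionFieldMap τ G) := by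
  subst hs'
  haveI : Fact p.Prime := ⟨hp⟩
  haveI := hchar
  haveI : CharP S'.functionField p := charP_of_injective_ringHom (RatFn.functionFieldMap τ).injective p
  refine cleanRegAt_of_centreBlowupCharts p (algebraMap (S.presheaf.stalk (τ s')) S.functionField)
    (IsFractionRing.injective _ _) (algebraMap (S'.presheaf.stalk s') S'.functionField) (IsFractionRing.injective _ _)
    (τ.stalkMap s').hom (RatFn.functionFieldMap τ) (fun a => RatFn.functionFieldMap_toFunctionField τ s' a)
    (stalkIdeal J (τ s')) ?_ hperm
  intro n c hc
  exact hτ.exists_reesChart_stalk s' c hc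

/-! ## Off the centre: a blowing up is a local isomorphism -/

/-- **Off `V(J)` clean-regularity is transported**: a blowing up along `J` is an isomorphism over the complement of the support of
`J` (`IsBlowup.isIso_compl`), so its stalk maps there are isomorphisms and `CleanRegAt` ascends
(`CleanRegAt.functionFieldMap_of_isIso_stalkMap`). [cite: GortzWedhorn2020, Prop. 13.91 (3)] -/
theorem cleanRegAt_of_isBlowup_of_not_mem_support (p : ℕ) {S : Scheme.{0}} [IsIntegral S] (G : S.functionField)
    (J : S.IdealSheafData) {S' : Scheme.{0}} (τ : S' ⟶ S) [IsIntegral S'] [IsDominant τ] (hτ : IsBlowup τ J) (s' : S')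
    (hs' : τ s' ∉ J.support) (h : CleanRegAt p (algebraMap (S.presheaf.stalk (τ s')) S.functionField) G) :
    CleanRegAt p (algebraMap (S'.presheaf.stalk s') S'.functionField) (RatFn.functionFieldMap τ G) := by
  haveI := hτ.isIso_compl
  haveI : IsIso (τ.stalkMap s') :=
    isIso_stalkMap_of_isIso_morphismRestrict τ ⟨(J.support : Set S)ᶜ, J.support.isClosed.isOpen_compl⟩ s' hs'
  exact h.functionFieldMap_of_isIso_stalkMap τ s'

/-! ## The step -/

/-- **THE STEP: after blowing up a centre which is clean-permissible at each of its points, the line is clean-regular everywhere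
upstairs.**  If the `K^p`-line of `G` is clean-regular at every point of the integral scheme `S` and clean-permissible for `J` at
every point of `V(J)`, then for every blowing up `τ : S' → S` along `J` the line of `τ^♯ G` is clean-regular at every point of `S'`
(over `V(J)` by `cleanRegAt_of_isBlowup_of_cleanPermissible`, elsewhere by `cleanRegAt_of_isBlowup_of_not_mem_support`).
[cite: Piltant2013, §2 Axiom 2 (ii) and Axiom 4] -/
theorem cleanRegAt_of_isBlowup_step (p : ℕ) (hp : p.Prime) {S : Scheme.{0}} [IsIntegral S]
    (hchar : CharP S.functionField p) (G : S.functionField)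
    (hG : ∀ s : S, CleanRegAt p (algebraMap (S.presheaf.stalk s) S.functionField) G) (J : S.IdealSheafData)
    (hperm : ∀ s ∈ J.support, ∃ (_ : IsRegularLocalRing (S.presheaf.stalk s)) (n l : ℕ) (c : Fin n → S.presheaf.stalk s)
        (w : Fin l → S.presheaf.stalk s),
      Ideal.span (Set.range (Fin.append c w)) = maximalIdeal (S.presheaf.stalk s) ∧
      ringKrullDim (S.presheaf.stalk s) = ((n + l : ℕ) : WithBot ℕ∞) ∧
      Ideal.span (Set.range c) = stalkIdeal J s ∧
      ∃ (cc : Fin p → S.functionField), (∃ j : Fin p, (j : ℕ) ≠ 0 ∧ cc j ≠ 0) ∧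
        ((∃ (a : Fin n → ℕ) (b : Fin l → ℕ) (u : S.presheaf.stalk s), IsUnit u ∧
            ((∃ k, ¬ p ∣ a k) ∨ (∃ m, ¬ p ∣ b m)) ∧
            (∑ j : Fin p, cc j ^ p * G ^ (j : ℕ)) =
              algebraMap (S.presheaf.stalk s) S.functionField (u * (∏ k, c k ^ a k) * ∏ m, w m ^ b m)) ∨
          (∃ u : S.presheaf.stalk s, IsUnit u ∧
            (∑ j : Fin p, cc j ^ p * G ^ (j : ℕ)) = algebraMap (S.presheaf.stalk s) S.functionField u ∧
            ∀ c' : S.presheaf.stalk s, u - c' ^ p ∉ maximalIdeal (S.presheaf.stalk s))))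
    {S' : Scheme.{0}} (τ : S' ⟶ S) [IsIntegral S'] [IsDominant τ] (hτ : IsBlowup τ J) (s' : S') :
    CleanRegAt p (algebraMap (S'.presheaf.stalk s') S'.functionField) (RatFn.functionFieldMap τ G) := by
  by_cases hs : τ s' ∈ J.support
  · exact cleanRegAt_of_isBlowup_of_cleanPermissible p hp hchar G J (τ s') (hperm _ hs) τ hτ s' rfl
  · exact cleanRegAt_of_isBlowup_of_not_mem_support p G J τ hτ s' hs (hG _)

end Summit.ResolutionOfSingularities.ResolutionOfSingularities.Theorems.RadicialJung.CleanModels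

end
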